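import Summits.Ventures.CertifiedManyBodySolver.Theorems.M3x2EdgeSplitSymReplaySyntax

/-!
# SymReplay checker — Part A-V (ADDITIVE SEAM): the EXECUTED anchored canonicaliser `symCheckV`
(team lb-sym, cell hub-lb; authored by hub-lb-sym-plan-1 g2 from `Cruxes/LowerEdge_ge_m83o100/Lines/symreplay.lean`
rev 10 l.412–442 / l.595–601 / l.2578–2615 (sym-ref-1 PATCH V, pen g0), per hub-lb-crit-1 V80 (B) «REV-10 SEAM RULE»:
the tree module `…SymReplaySyntax` (T1, reviewed, 8 dependents) is NOT re-cut; this module only ADDS.)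

WHY.  T1's `identityOK` runs `canonTermA (flatSite (minCorner K.frame))`.  A `def` returning `Site 2 = Fin 2 → ℤ`
compiles at arity +1, so `let m := minCorner l`, `flatSite x` and a moved letter's site are PARTIAL APPLICATIONS
re-evaluated at every coordinate access on the compiled / IR-interpreted path (`native_decide`, `#eval`): `minCorner`
costs `2^|list|` and `flatSite` flattens nothing — at `|frame| = 625` the T1 path does not terminate in 1 000 s
(sym-plan-1 g0 RESULT-8, 4 probes), while the kernel path (`decide +kernel`) is unaffected.  Cure, SAME ALGORITHM:
compute `ℤ` values first and build sites from values only (`minCornerP`, `moveWordV`, `anchoredNFsV`, `canonAV`,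
`canonTermAV`; 2.20 ms/term at 625 sites, sym-ref-1 l.1224/l.1277).  `symCheckV` runs these, and

  `theorem symCheckV_eq (K : SymCert) : symCheckV K = symCheck K`

makes every soundness statement over `symCheck` (T2–T11, `energyDensity_ge_symValue`, `nearCertWardSlack_of_symCert`)
apply verbatim to a certificate decided by `symCheckV`.  CLOSING GRAMMAR of a data module:

  `have h : symCheckV K = true := by native_decide`
  `… energyDensity_ge_symValue K ((symCheckV_eq K) ▸ h)`      -- resp. `nearCertWardSlack_of_symCert K (… ▸ h) (by decide)`

LAYOUT for the lander (hub-lb-sym-eng-3): `section SyntaxV` = computable defs only (statement-class); `section SyntaxVEq`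
= the bridging lemmas (≤ 60 lines of proof) + one kernel regression; split at the section boundary if the gate's
statement-only rule requires it.  Imports ONLY T1.  No summit or crux statement is proved here; no certificate beyond the
toy is replayed here; nothing here predicts superconductivity.
-/

namespace Summit.Ventures.CertifiedManyBodySolver.Theorems.SymReplay

open Literature.Probability.LatticeModels (Site)

section SyntaxV

/-- A site from two computed integers. -/
def mkSite (a b : ℤ) : Site 2 := ![a, b]

/-- Componentwise minimum of a site list as a PAIR of integers (junk `(0,0)` on `[]`); see `minCornerP_eq`. -/
def minCornerP : List (Site 2) → ℤ × ℤ
  | [] => (0, 0)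
  | [x] => (x 0, x 1)
  | x :: l => let m := minCornerP l; (min (x 0) m.1, min (x 1) m.2)

/-- Moved word with every letter site rebuilt from two computed integers (`= moveWordF`, see `moveWordV_eq`). -/
def moveWordV (γ : DihedralGroup 4) (v : Site 2) (w : Word) : Word :=
  w.map fun ℓ => let y := moveSite γ v ℓ.x; let a := y 0; let b := y 1; ⟨mkSite a b, ℓ.s, ℓ.dag⟩

/-- `anchoredNFs` with first-order plumbing (`= anchoredNFs (mkSite cP.1 cP.2)`, see `anchoredNFsV_eq`). -/
def anchoredNFsV (cP : ℤ × ℤ) (frame : List (Site 2)) (u : Word) : List QPoly :=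
  d4All.filterMap fun γ =>
    let m := minCornerP (wordSites (moveWordV γ 0 u))
    let a := cP.1 - m.1
    let b := cP.2 - m.2
    let w := moveWordV γ (mkSite a b) u
    if suppIn w frame then some (nfWord w) else none

/-- `canonA` with first-order plumbing (`= canonA (mkSite cP.1 cP.2)`, see `canonAV_eq`). -/
def canonAV (cP : ℤ × ℤ) (frame : List (Site 2)) (u : Word) : QPoly :=
  match anchoredNFsV cP frame u with
  | [] => [(1, u)]
  | c :: cs =>
    let best := cs.foldl (fun b c' => if polyKeyLt c' b then c' else b) c
    if (c :: cs).any (polyNegEq best) then [] else best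

/-- `canonTermA` with first-order plumbing (`= canonTermA (mkSite cP.1 cP.2)`, see `canonTermAV_eq`). -/
def canonTermAV (cP : ℤ × ℤ) (frame : List (Site 2)) (t : ℚ × Word) : QPoly := pscale t.1 (canonAV cP frame t.2)

/-- The identity test of `identityOK`, EXECUTED form: same normal-order / collect / optional canonical quotient /
zero test, with the frame corner computed once as an integer pair and the first-order canonicaliser `canonTermAV`
(`= identityOK`, see `identityOKV_eq`). -/
def identityOKV (K : SymCert) : Bool :=
  let N := collect (nfPoly (psub (lhsPoly K) (rhsPoly K)))
  let cP := minCornerP K.frame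
  isZero (if K.useCanon then N.flatMap (canonTermAV cP K.frame) else N)

/-- **The executed checker** (`= symCheck`, see `symCheckV_eq`): decide THIS one by `native_decide` in data modules. -/
def symCheckV (K : SymCert) : Bool := wellFormed K && identityOKV K

end SyntaxV

/-! ## Part A-V′ — the executed canonicaliser equals the specification (bridging lemmas, rev 10 Part B) -/

section SyntaxVEq

theorem moveWordV_eq : moveWordV = moveWordF := rfl

theorem minCornerP_eq : ∀ L : List (Site 2), minCornerP L = (minCorner L 0, minCorner L 1)
  | [] => rfl
  | [x] => rfl
  | x :: y :: l => by
    show (min (x 0) (minCornerP (y :: l)).1, min (x 1) (minCornerP (y :: l)).2) =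
      ((![min (x 0) (minCorner (y :: l) 0), min (x 1) (minCorner (y :: l) 1)] : Site 2) 0,
       (![min (x 0) (minCorner (y :: l) 0), min (x 1) (minCorner (y :: l) 1)] : Site 2) 1)
    rw [minCornerP_eq (y :: l)]
    rfl

theorem mkSite_anchor_eq (cP : ℤ × ℤ) (L : List (Site 2)) :
    mkSite (cP.1 - (minCornerP L).1) (cP.2 - (minCornerP L).2) = flatSite (mkSite cP.1 cP.2 - minCorner L) := by
  rw [minCornerP_eq]
  funext i
  fin_cases i <;> rfl

theorem anchoredNFsV_eq (cP : ℤ × ℤ) (frame : List (Site 2)) (u : Word) :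
    anchoredNFsV cP frame u = anchoredNFs (mkSite cP.1 cP.2) frame u := by
  unfold anchoredNFsV anchoredNFs
  congr 1
  funext γ
  simp only [moveWordV_eq, mkSite_anchor_eq]

theorem canonAV_eq (cP : ℤ × ℤ) (frame : List (Site 2)) (u : Word) :
    canonAV cP frame u = canonA (mkSite cP.1 cP.2) frame u := by
  unfold canonAV canonA
  rw [anchoredNFsV_eq]
  -- the two `match` auxiliaries (`canonAV.match_1`, T1's `canonA.match_1`) are distinct constants with equal bodies
  rfl

theorem canonTermAV_eq (cP : ℤ × ℤ) (frame : List (Site 2)) :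
    canonTermAV cP frame = canonTermA (mkSite cP.1 cP.2) frame := by
  funext t
  unfold canonTermAV canonTermA
  rw [canonAV_eq]

/-- The executed corner is T1's corner `flatSite (minCorner frame)`. -/
theorem cornerV_eq (L : List (Site 2)) : mkSite (minCornerP L).1 (minCornerP L).2 = flatSite (minCorner L) := by
  rw [minCornerP_eq]
  rfl

theorem identityOKV_eq (K : SymCert) : identityOKV K = identityOK K := by
  unfold identityOKV identityOK
  simp only [canonTermAV_eq, cornerV_eq]

/-- **The seam**: the executed checker IS the specified checker, so every soundness theorem over `symCheck`
transports along `(symCheckV_eq K) ▸ ·`. -/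
theorem symCheckV_eq (K : SymCert) : symCheckV K = symCheck K := by
  unfold symCheckV symCheck
  rw [identityOKV_eq]

/-- Transport helper for data modules: `symCheck K = true` from the `native_decide`d executed check. -/
theorem symCheck_of_symCheckV (K : SymCert) (h : symCheckV K = true) : symCheck K = true :=
  (symCheckV_eq K) ▸ h

/-- Kernel regression (no `Lean.ofReduceBool`): the lever toy (`useCanon := true`, frame `5 × 5`) passes the
EXECUTED checker in the kernel, exactly as `toyCanonCert_check` passes `symCheck` (module `…NormalOrder`). -/
theorem toyCanonCert_checkV : symCheckV toyCanonCert = true := by decide +kernel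

end SyntaxVEq

end Summit.Ventures.CertifiedManyBodySolver.Theorems.SymReplay
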